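import Literature.NumberTheory.LFunctions.WeilTwoPrimeDeflM72YDef
import Literature.NumberTheory.LFunctions.WeilTwoPrimeDeflM72YDataPO23
import Literature.NumberTheory.LFunctions.WeilBlockRowsR
import HarnessLib

/-!
# Deflated two-prime certificate M72Y: the materialized odd block agrees with `P_r + Σ μ ĉ ĉᵀ`, rows 50–59

`WeilCert.checkPmRowG` for certificate M72Y (odd block), by `decide +kernel`. Pure proof file; nothing is asserted.
-/

noncomputable section

namespace Literature.NumberTheory.LFunctions

set_option maxHeartbeats 0 in
/-- Row 50 of the materialized odd block is row 50 of `P_r + Σ μ ĉ ĉᵀ` (certificate M72Y). [folklore] -/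
theorem checkPmRowG1_50_weilCertDeflM72Y : weilCertDeflM72YBase.checkPmRowG weilCertDeflM72YP weilCertDeflM72YPmO 1 50 = true := by
  decide +kernel

set_option maxHeartbeats 0 in
/-- Row 51 of the materialized odd block is row 51 of `P_r + Σ μ ĉ ĉᵀ` (certificate M72Y). [folklore] -/
theorem checkPmRowG1_51_weilCertDeflM72Y : weilCertDeflM72YBase.checkPmRowG weilCertDeflM72YP weilCertDeflM72YPmO 1 51 = true := by
  decide +kernel

set_option maxHeartbeats 0 in
/-- Row 52 of the materialized odd block is row 52 of `P_r + Σ μ ĉ ĉᵀ` (certificate M72Y). [folklore] -/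
theorem checkPmRowG1_52_weilCertDeflM72Y : weilCertDeflM72YBase.checkPmRowG weilCertDeflM72YP weilCertDeflM72YPmO 1 52 = true := by
  decide +kernel

set_option maxHeartbeats 0 in
/-- Row 53 of the materialized odd block is row 53 of `P_r + Σ μ ĉ ĉᵀ` (certificate M72Y). [folklore] -/
theorem checkPmRowG1_53_weilCertDeflM72Y : weilCertDeflM72YBase.checkPmRowG weilCertDeflM72YP weilCertDeflM72YPmO 1 53 = true := by
  decide +kernel

set_option maxHeartbeats 0 in
/-- Row 54 of the materialized odd block is row 54 of `P_r + Σ μ ĉ ĉᵀ` (certificate M72Y). [folklore] -/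
theorem checkPmRowG1_54_weilCertDeflM72Y : weilCertDeflM72YBase.checkPmRowG weilCertDeflM72YP weilCertDeflM72YPmO 1 54 = true := by
  decide +kernel

set_option maxHeartbeats 0 in
/-- Row 55 of the materialized odd block is row 55 of `P_r + Σ μ ĉ ĉᵀ` (certificate M72Y). [folklore] -/
theorem checkPmRowG1_55_weilCertDeflM72Y : weilCertDeflM72YBase.checkPmRowG weilCertDeflM72YP weilCertDeflM72YPmO 1 55 = true := by
  decide +kernel

set_option maxHeartbeats 0 in
/-- Row 56 of the materialized odd block is row 56 of `P_r + Σ μ ĉ ĉᵀ` (certificate M72Y). [folklore] -/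
theorem checkPmRowG1_56_weilCertDeflM72Y : weilCertDeflM72YBase.checkPmRowG weilCertDeflM72YP weilCertDeflM72YPmO 1 56 = true := by
  decide +kernel

set_option maxHeartbeats 0 in
/-- Row 57 of the materialized odd block is row 57 of `P_r + Σ μ ĉ ĉᵀ` (certificate M72Y). [folklore] -/
theorem checkPmRowG1_57_weilCertDeflM72Y : weilCertDeflM72YBase.checkPmRowG weilCertDeflM72YP weilCertDeflM72YPmO 1 57 = true := by
  decide +kernel

set_option maxHeartbeats 0 in
/-- Row 58 of the materialized odd block is row 58 of `P_r + Σ μ ĉ ĉᵀ` (certificate M72Y). [folklore] -/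
theorem checkPmRowG1_58_weilCertDeflM72Y : weilCertDeflM72YBase.checkPmRowG weilCertDeflM72YP weilCertDeflM72YPmO 1 58 = true := by
  decide +kernel

set_option maxHeartbeats 0 in
/-- Row 59 of the materialized odd block is row 59 of `P_r + Σ μ ĉ ĉᵀ` (certificate M72Y). [folklore] -/
theorem checkPmRowG1_59_weilCertDeflM72Y : weilCertDeflM72YBase.checkPmRowG weilCertDeflM72YP weilCertDeflM72YPmO 1 59 = true := by
  decide +kernel


end Literature.NumberTheory.LFunctions
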